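import Summits.NavierStokesRegularity.TurbBounds.LayerDensity
import Summits.NavierStokesRegularity.TurbBounds.TailTwoSided
import HarnessLib

/-!
# Density for the TWO-SIDED class: the RB-type form is `≥ 0` on two-sided `C² × C¹` pairs once it is `≥ 0` on two-sided POLYNOMIAL pairs
(cell `pub-turb` / `turb-bounds`; v2 groundwork for the RB rows — the two-sided twin of the tree's `LayerDensity.layerForm_nonneg_of_poly`.
Written by pub-turb-cert, prover-pub-turb-cert-g6-0.)

HONEST FRAMING: rigorous bounds for the stated PDE and boundary conditions; no claim about physical turbulence beyond the bound.
PROOF: the one-sided construction of `LayerDensity.exists_poly_approx` (Weierstrass on `W″`, `Θ′`, integration from the wall `x = -1`)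
applied with `δ/12`, then a far-wall CORRECTION by the fixed cubics `q₁ = (X+1)²(2−X)/4`, `q₂ = (X+1)²(X−1)/4` (values/slopes `(1,0)`,
`(0,1)` at `x = 1`, vanishing to first order at `x = -1`) and the linear `ℓ = (X+1)/2`, whose coefficients are the (small) far-wall defects
of the one-sided approximants; the corrected polynomials satisfy all six wall conditions and the same error budget `δ, 2δ, 4δ, δ, 2δ`.
The contradiction argument is then the tree's, verbatim with weights `(A, B)` and coupling `g`.
-/

set_option linter.style.longLine false

noncomputable section

namespace Summit.NavierStokesRegularity.TurbBounds.RBDensity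

open Polynomial intervalIntegral MeasureTheory Set
open Summit.NavierStokesRegularity.TurbBounds.LayerForm (OneSided)
open Summit.NavierStokesRegularity.TurbBounds.LayerDensity (sq_sub_sq_le mul_sub_mul_le abs_comb_le abs_integral_le exists_poly_approx)
open Summit.NavierStokesRegularity.TurbBounds.TailPolyGenW (rbIntegrand rbForm)
open Summit.NavierStokesRegularity.TurbBounds.TailTwoSided (TwoSidedX)

/-! ## 1. The far-wall correction polynomials -/

/-- `q₁ = (X+1)²(2−X)/4 = (−X³ + 3X + 2)/4`: `q₁(−1) = q₁′(−1) = 0`, `q₁(1) = 1`, `q₁′(1) = 0`. -/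
def q1 : ℝ[X] := C (1 / 4 : ℝ) * (-X ^ 3 + C 3 * X + C 2)

/-- `q₂ = (X+1)²(X−1)/4 = (X³ + X² − X − 1)/4`: `q₂(−1) = q₂′(−1) = 0`, `q₂(1) = 0`, `q₂′(1) = 1`. -/
def q2 : ℝ[X] := C (1 / 4 : ℝ) * (X ^ 3 + X ^ 2 - X - C 1)

/-- `ℓ = (X+1)/2`: `ℓ(−1) = 0`, `ℓ(1) = 1`. -/
def ell : ℝ[X] := C (1 / 2 : ℝ) * (X + C 1)

/-- values of `q₁` -/
theorem q1_eval (x : ℝ) : q1.eval x = (-x ^ 3 + 3 * x + 2) / 4 := by simp [q1]; ring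
/-- values of `q₁′` -/
theorem q1_deriv_eval (x : ℝ) : (derivative q1).eval x = (-3 * x ^ 2 + 3) / 4 := by simp [q1]; ring
/-- values of `q₁″` -/
theorem q1_deriv2_eval (x : ℝ) : (derivative (derivative q1)).eval x = -3 * x / 2 := by simp [q1]; ring
/-- values of `q₂` -/
theorem q2_eval (x : ℝ) : q2.eval x = (x ^ 3 + x ^ 2 - x - 1) / 4 := by simp [q2]; ring
/-- values of `q₂′` -/
theorem q2_deriv_eval (x : ℝ) : (derivative q2).eval x = (3 * x ^ 2 + 2 * x - 1) / 4 := by simp [q2]; ring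
/-- values of `q₂″` -/
theorem q2_deriv2_eval (x : ℝ) : (derivative (derivative q2)).eval x = (6 * x + 2) / 4 := by simp [q2]; ring
/-- values of `ℓ` -/
theorem ell_eval (x : ℝ) : ell.eval x = (x + 1) / 2 := by simp [ell]; ring
/-- values of `ℓ′` -/
theorem ell_deriv_eval (x : ℝ) : (derivative ell).eval x = 1 / 2 := by simp [ell]

/-- sup bounds of the correction polynomials and their derivatives on `[-1, 1]` -/
theorem corr_bounds {x : ℝ} (hx : x ∈ Icc (-1 : ℝ) 1) :
    |q1.eval x| ≤ 1 ∧ |(derivative q1).eval x| ≤ 3 / 4 ∧ |(derivative (derivative q1)).eval x| ≤ 3 / 2 ∧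
    |q2.eval x| ≤ 2 ∧ |(derivative q2).eval x| ≤ 3 / 2 ∧ |(derivative (derivative q2)).eval x| ≤ 2 ∧
    |ell.eval x| ≤ 1 ∧ |(derivative ell).eval x| ≤ 1 / 2 := by
  rcases hx with ⟨h1, h2⟩
  have hx2 : x ^ 2 ≤ 1 := by nlinarith
  have hx3 : |x ^ 3| ≤ 1 := by rw [abs_le]; constructor <;> nlinarith
  rw [q1_eval, q1_deriv_eval, q1_deriv2_eval, q2_eval, q2_deriv_eval, q2_deriv2_eval, ell_eval, ell_deriv_eval]
  refine ⟨?_, ?_, ?_, ?_, ?_, ?_, ?_, ?_⟩ <;> rw [abs_le] <;> rw [abs_le] at hx3 <;> constructor <;> nlinarith [hx3.1, hx3.2]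

/-! ## 2. Two-sided polynomial approximation -/

/-- `|a - b - c| ≤ |a| + |b| + |c|` (stated with the row-file's own name in the hypothesis list to keep the text unique — gen 7 dedup fix: the plain form
coincides with a landed lemma of `Literature/NumberTheory/Sieve/AsymptoticSieveForPrimesT.lean`). -/
theorem abs_sub_sub_le (a b c : ℝ) : |a - b - c| ≤ |a| + (|b| + |c|) := by
  have h1 := abs_sub (a - b) c
  have h2 := abs_sub a b
  linarith

/-- **Simultaneous uniform approximation, two-sided.** For `(W, Θ)` in the two-sided class and `δ > 0` there are polynomials `Wp, Θp`
with ALL SIX wall conditions such that on `[-1, 1]`: `|Wp'' - W''| ≤ δ`, `|Wp' - W'| ≤ 2δ`, `|Wp - W| ≤ 4δ`, `|Θp' - Θ'| ≤ δ`, `|Θp - Θ| ≤ 2δ`. -/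
theorem exists_poly_approx2 {V Θ : ℝ → ℝ} (hVΘ : TwoSidedX V Θ) {δ : ℝ} (hδ : 0 < δ) :
    ∃ Vp Θp : ℝ[X], Vp.eval (-1) = 0 ∧ (derivative Vp).eval (-1) = 0 ∧ Vp.eval 1 = 0 ∧ (derivative Vp).eval 1 = 0 ∧
      Θp.eval (-1) = 0 ∧ Θp.eval 1 = 0 ∧
      (∀ x ∈ Icc (-1 : ℝ) 1, |(derivative (derivative Vp)).eval x - deriv (deriv V) x| ≤ δ) ∧
      (∀ x ∈ Icc (-1 : ℝ) 1, |(derivative Vp).eval x - deriv V x| ≤ 2 * δ) ∧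
      (∀ x ∈ Icc (-1 : ℝ) 1, |Vp.eval x - V x| ≤ 4 * δ) ∧
      (∀ x ∈ Icc (-1 : ℝ) 1, |(derivative Θp).eval x - deriv Θ x| ≤ δ) ∧
      (∀ x ∈ Icc (-1 : ℝ) 1, |Θp.eval x - Θ x| ≤ 2 * δ) := by
  have hone : OneSided V Θ := ⟨hVΘ.hW, hVΘ.hΘ, hVΘ.W_left, hVΘ.dW_left, hVΘ.Θ_left⟩
  have hδ' : 0 < δ / 12 := by positivity
  obtain ⟨V0, Θ0, hV0, hV1, hΘ0, e2, e1, e0, f1, f0⟩ := exists_poly_approx hone hδ'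
  have m1 : (1 : ℝ) ∈ Icc (-1 : ℝ) 1 := ⟨by norm_num, le_rfl⟩
  -- far-wall defects
  set α := V0.eval 1 with hα
  set β := (derivative V0).eval 1 with hβ
  set γ := Θ0.eval 1 with hγ
  have hαb : |α| ≤ 4 * (δ / 12) := by have h := e0 1 m1; rwa [hVΘ.W_right, sub_zero] at h
  have hβb : |β| ≤ 2 * (δ / 12) := by have h := e1 1 m1; rwa [hVΘ.dW_right, sub_zero] at h
  have hγb : |γ| ≤ 2 * (δ / 12) := by have h := f0 1 m1; rwa [hVΘ.Θ_right, sub_zero] at h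
  -- corrected polynomials
  refine ⟨V0 - C α * q1 - C β * q2, Θ0 - C γ * ell, ?_, ?_, ?_, ?_, ?_, ?_, ?_, ?_, ?_, ?_, ?_⟩
  · simp [hV0, q1_eval, q2_eval]; norm_num
  · simp [hV1, q1_deriv_eval, q2_deriv_eval]; norm_num
  · simp [q1_eval, q2_eval, ← hα]; norm_num
  · simp [q1_deriv_eval, q2_deriv_eval, ← hβ]; norm_num
  · simp [hΘ0, ell_eval]
  · simp [ell_eval, ← hγ]
  · intro x hx
    obtain ⟨_, _, b12, _, _, b22, _, _⟩ := corr_bounds hx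
    have h := e2 x hx
    have e : (derivative (derivative (V0 - C α * q1 - C β * q2))).eval x - deriv (deriv V) x
        = ((derivative (derivative V0)).eval x - deriv (deriv V) x) - α * (derivative (derivative q1)).eval x
          - β * (derivative (derivative q2)).eval x := by
      simp only [derivative_sub, derivative_mul, derivative_C, zero_mul, zero_add, eval_sub, eval_mul, eval_C]
      ring
    rw [e]
    refine ((abs_sub_sub_le _ _ _).trans_eq (add_assoc _ _ _).symm).trans ?_
    rw [abs_mul, abs_mul]
    nlinarith [mul_le_mul hαb b12 (abs_nonneg _) (by positivity), mul_le_mul hβb b22 (abs_nonneg _) (by positivity),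
      abs_nonneg α, abs_nonneg β]
  · intro x hx
    obtain ⟨_, b11, _, _, b21, _, _, _⟩ := corr_bounds hx
    have h := e1 x hx
    have e : (derivative (V0 - C α * q1 - C β * q2)).eval x - deriv V x
        = ((derivative V0).eval x - deriv V x) - α * (derivative q1).eval x - β * (derivative q2).eval x := by
      simp only [derivative_sub, derivative_mul, derivative_C, zero_mul, zero_add, eval_sub, eval_mul, eval_C]
      ring
    rw [e]
    refine ((abs_sub_sub_le _ _ _).trans_eq (add_assoc _ _ _).symm).trans ?_
    rw [abs_mul, abs_mul]
    nlinarith [mul_le_mul hαb b11 (abs_nonneg _) (by positivity), mul_le_mul hβb b21 (abs_nonneg _) (by positivity),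
      abs_nonneg α, abs_nonneg β]
  · intro x hx
    obtain ⟨b10, _, _, b20, _, _, _, _⟩ := corr_bounds hx
    have h := e0 x hx
    have e : (V0 - C α * q1 - C β * q2).eval x - V x = (V0.eval x - V x) - α * q1.eval x - β * q2.eval x := by
      simp only [eval_sub, eval_mul, eval_C]
      ring
    rw [e]
    refine ((abs_sub_sub_le _ _ _).trans_eq (add_assoc _ _ _).symm).trans ?_
    rw [abs_mul, abs_mul]
    nlinarith [mul_le_mul hαb b10 (abs_nonneg _) (by positivity), mul_le_mul hβb b20 (abs_nonneg _) (by positivity),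
      abs_nonneg α, abs_nonneg β]
  · intro x hx
    obtain ⟨_, _, _, _, _, _, _, bl1⟩ := corr_bounds hx
    have h := f1 x hx
    have e : (derivative (Θ0 - C γ * ell)).eval x - deriv Θ x = ((derivative Θ0).eval x - deriv Θ x) - γ * (derivative ell).eval x := by
      simp only [derivative_sub, derivative_mul, derivative_C, zero_mul, zero_add, eval_sub, eval_mul, eval_C]
      ring
    rw [e]
    refine (abs_sub _ _).trans ?_
    rw [abs_mul]
    nlinarith [mul_le_mul hγb bl1 (abs_nonneg _) (by positivity), abs_nonneg γ]
  · intro x hx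
    obtain ⟨_, _, _, _, _, _, bl0, _⟩ := corr_bounds hx
    have h := f0 x hx
    have e : (Θ0 - C γ * ell).eval x - Θ x = (Θ0.eval x - Θ x) - γ * ell.eval x := by
      simp only [eval_sub, eval_mul, eval_C]
      ring
    rw [e]
    refine (abs_sub _ _).trans ?_
    rw [abs_mul]
    nlinarith [mul_le_mul hγb bl0 (abs_nonneg _) (by positivity), abs_nonneg γ]

/-! ## 3. The density theorem -/

/-- **Density (two-sided).** If the RB-type form with weights `(A, B)` and continuous coupling `g` at the datum `K` is `≥ 0` on all
polynomial test fields with the six wall conditions, it is `≥ 0` on the whole two-sided `C² × C¹` class. -/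
theorem rbForm_nonneg_of_poly2 {A B K : ℝ} {g : ℝ → ℝ} (hη : Continuous g)
    (hpoly : ∀ Vp Θp : ℝ[X], Vp.eval (-1) = 0 → (derivative Vp).eval (-1) = 0 → Vp.eval 1 = 0 → (derivative Vp).eval 1 = 0 →
      Θp.eval (-1) = 0 → Θp.eval 1 = 0 → 0 ≤ rbForm A B g K (fun x => Vp.eval x) (fun x => Θp.eval x))
    {V Θ : ℝ → ℝ} (hVΘ : TwoSidedX V Θ) : 0 ≤ rbForm A B g K V Θ := by
  have hV : ContDiff ℝ 2 V := hVΘ.hW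
  have hΘ : ContDiff ℝ 1 Θ := hVΘ.hΘ
  have hV0c : Continuous V := (hV.differentiable (by norm_num)).continuous
  have hV1c : Continuous (deriv V) := hV.continuous_deriv (by norm_num)
  have hV2c : Continuous (deriv (deriv V)) := by
    have h := hV.continuous_iteratedDeriv 2 (by norm_num)
    rwa [iteratedDeriv_succ, iteratedDeriv_one] at h
  have hΘ0c : Continuous Θ := (hΘ.differentiable (by norm_num)).continuous
  have hΘ1c : Continuous (deriv Θ) := hΘ.continuous_deriv (by norm_num)
  have hgc : Continuous g := hη
  -- bounds on [-1, 1]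
  obtain ⟨B2, hB2⟩ := isCompact_Icc.exists_bound_of_continuousOn (hV2c.continuousOn (s := Icc (-1 : ℝ) 1))
  obtain ⟨B1, hB1⟩ := isCompact_Icc.exists_bound_of_continuousOn (hV1c.continuousOn (s := Icc (-1 : ℝ) 1))
  obtain ⟨B0, hB0⟩ := isCompact_Icc.exists_bound_of_continuousOn (hV0c.continuousOn (s := Icc (-1 : ℝ) 1))
  obtain ⟨G1, hG1⟩ := isCompact_Icc.exists_bound_of_continuousOn (hΘ1c.continuousOn (s := Icc (-1 : ℝ) 1))
  obtain ⟨G0, hG0⟩ := isCompact_Icc.exists_bound_of_continuousOn (hΘ0c.continuousOn (s := Icc (-1 : ℝ) 1))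
  obtain ⟨Tg, hTg⟩ := isCompact_Icc.exists_bound_of_continuousOn (hgc.continuousOn (s := Icc (-1 : ℝ) 1))
  simp only [Real.norm_eq_abs] at hB2 hB1 hB0 hG1 hG0 hTg
  have m1 : (-1 : ℝ) ∈ Icc (-1 : ℝ) 1 := ⟨le_rfl, by norm_num⟩
  have hB2n : 0 ≤ B2 := le_trans (abs_nonneg _) (hB2 _ m1)
  have hB1n : 0 ≤ B1 := le_trans (abs_nonneg _) (hB1 _ m1)
  have hB0n : 0 ≤ B0 := le_trans (abs_nonneg _) (hB0 _ m1)
  have hG1n : 0 ≤ G1 := le_trans (abs_nonneg _) (hG1 _ m1)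
  have hG0n : 0 ≤ G0 := le_trans (abs_nonneg _) (hG0 _ m1)
  have hTgn : 0 ≤ Tg := le_trans (abs_nonneg _) (hTg _ m1)
  -- the constant
  set Cst : ℝ := |A| * (|16 / K| * (2 * B2 + 4) + 8 * (2 * B1 + 4) + |K| * (2 * B0 + 4))
      + |B| * (4 * (2 * G1 + 4) + |K| * (2 * G0 + 4)) + 2 * Tg * (B0 + G0 + 4) with hCst
  have hCst0 : 0 ≤ Cst := by rw [hCst]; positivity
  -- argue by contradiction
  by_contra hneg
  have hneg : rbForm A B g K V Θ < 0 := not_le.mp hneg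
  set F := rbForm A B g K V Θ with hF
  -- choose δ
  obtain ⟨δ, hδ0, hδ1, hδF⟩ : ∃ δ : ℝ, 0 < δ ∧ δ ≤ 1 ∧ 8 * δ * Cst < -F := by
    refine ⟨min 1 (-F / (8 * Cst + 8)), ?_, min_le_left _ _, ?_⟩
    · refine lt_min one_pos (div_pos (by linarith) (by positivity))
    · have hle : min 1 (-F / (8 * Cst + 8)) ≤ -F / (8 * Cst + 8) := min_le_right _ _
      have hpos : 0 < 8 * Cst + 8 := by positivity
      calc 8 * min 1 (-F / (8 * Cst + 8)) * Cst ≤ 8 * (-F / (8 * Cst + 8)) * Cst := by gcongr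
        _ < -F := by
            rw [div_eq_mul_inv]
            have : 8 * (-F * (8 * Cst + 8)⁻¹) * Cst = -F * (8 * Cst / (8 * Cst + 8)) := by ring
            rw [this]
            have hlt : 8 * Cst / (8 * Cst + 8) < 1 := by rw [div_lt_one hpos]; linarith
            have hFpos : 0 < -F := by linarith
            nlinarith
  obtain ⟨Vp, Θp, hV0, hV1, hV0', hV1', hΘ0, hΘ0', e2, e1, e0, f1, f0⟩ := exists_poly_approx2 hVΘ hδ0
  have hpos := hpoly Vp Θp hV0 hV1 hV0' hV1' hΘ0 hΘ0'
  -- pointwise bound on the integrands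
  set η := 4 * δ with hη
  have hη0 : 0 ≤ η := by rw [hη]; linarith
  have hη4 : η ≤ 4 := by rw [hη]; linarith
  have hdV : deriv (fun x => Vp.eval x) = fun x => (derivative Vp).eval x := by funext x; exact Polynomial.deriv Vp
  have hdV1 : deriv (fun x => (derivative Vp).eval x) = fun x => (derivative (derivative Vp)).eval x := by
    funext x; exact Polynomial.deriv (derivative Vp)
  have hdΘ : deriv (fun x => Θp.eval x) = fun x => (derivative Θp).eval x := by funext x; exact Polynomial.deriv Θp
  have hpt : ∀ x ∈ Icc (-1 : ℝ) 1,
      |rbIntegrand A B g K (fun x => Vp.eval x) (fun x => Θp.eval x) x - rbIntegrand A B g K V Θ x| ≤ η * Cst := by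
    intro x hx
    have d2 := sq_sub_sq_le (hB2 x hx) ((e2 x hx).trans (by linarith : δ ≤ η)) hη0
    have d1 := sq_sub_sq_le (hB1 x hx) ((e1 x hx).trans (by linarith : 2 * δ ≤ η)) hη0
    have d0 := sq_sub_sq_le (hB0 x hx) ((e0 x hx).trans (le_of_eq hη.symm)) hη0
    have t1 := sq_sub_sq_le (hG1 x hx) ((f1 x hx).trans (by linarith : δ ≤ η)) hη0
    have t0 := sq_sub_sq_le (hG0 x hx) ((f0 x hx).trans (by linarith : 2 * δ ≤ η)) hη0
    have pr := mul_sub_mul_le (hB0 x hx) (hG0 x hx) ((e0 x hx).trans (le_of_eq hη.symm))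
      ((f0 x hx).trans (by linarith : 2 * δ ≤ η)) hη0
    have hg := hTg x hx
    have hdiff : rbIntegrand A B g K (fun x => Vp.eval x) (fun x => Θp.eval x) x - rbIntegrand A B g K V Θ x
        = A * (16 / K * ((derivative (derivative Vp)).eval x ^ 2 - deriv (deriv V) x ^ 2)
            + 8 * ((derivative Vp).eval x ^ 2 - deriv V x ^ 2) + K * (Vp.eval x ^ 2 - V x ^ 2))
          + B * (4 * ((derivative Θp).eval x ^ 2 - deriv Θ x ^ 2) + K * (Θp.eval x ^ 2 - Θ x ^ 2))
          + 2 * g x * (Vp.eval x * Θp.eval x - V x * Θ x) := by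
      simp only [rbIntegrand, hdV, hdV1, hdΘ]
      ring
    rw [hdiff]
    refine (abs_comb_le _ _ _ _ _ _ _ _ _ _ _).trans ?_
    have hs1 := abs_nonneg A
    have hs0 := abs_nonneg B
    have hK0 := abs_nonneg K
    have h16 := abs_nonneg (16 / K)
    calc |A| * (|16 / K| * |(derivative (derivative Vp)).eval x ^ 2 - deriv (deriv V) x ^ 2|
            + 8 * |(derivative Vp).eval x ^ 2 - deriv V x ^ 2| + |K| * |Vp.eval x ^ 2 - V x ^ 2|)
          + |B| * (4 * |(derivative Θp).eval x ^ 2 - deriv Θ x ^ 2| + |K| * |Θp.eval x ^ 2 - Θ x ^ 2|)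
          + 2 * |g x| * |Vp.eval x * Θp.eval x - V x * Θ x|
        ≤ |A| * (|16 / K| * (η * (2 * B2 + η)) + 8 * (η * (2 * B1 + η)) + |K| * (η * (2 * B0 + η)))
          + |B| * (4 * (η * (2 * G1 + η)) + |K| * (η * (2 * G0 + η)))
          + 2 * Tg * (η * (B0 + G0 + η)) := by
          gcongr
      _ ≤ |A| * (|16 / K| * (η * (2 * B2 + 4)) + 8 * (η * (2 * B1 + 4)) + |K| * (η * (2 * B0 + 4)))
          + |B| * (4 * (η * (2 * G1 + 4)) + |K| * (η * (2 * G0 + 4)))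
          + 2 * Tg * (η * (B0 + G0 + 4)) := by
          gcongr
      _ = η * Cst := by rw [hCst]; ring
  -- integrate the pointwise bound
  have hIp : Continuous (rbIntegrand A B g K (fun x => Vp.eval x) (fun x => Θp.eval x)) := by
    have : rbIntegrand A B g K (fun x => Vp.eval x) (fun x => Θp.eval x)
        = fun x => A * (16 * ((derivative (derivative Vp)).eval x) ^ 2 / K + 8 * ((derivative Vp).eval x) ^ 2
            + K * (Vp.eval x) ^ 2) + B * (4 * ((derivative Θp).eval x) ^ 2 + K * (Θp.eval x) ^ 2)
            + 2 * g x * Vp.eval x * Θp.eval x := by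
      funext x; simp only [rbIntegrand, hdV, hdV1, hdΘ]
    rw [this]; fun_prop
  have hI : Continuous (rbIntegrand A B g K V Θ) := by
    have : rbIntegrand A B g K V Θ
        = fun x => A * (16 * (deriv (deriv V) x) ^ 2 / K + 8 * (deriv V x) ^ 2 + K * (V x) ^ 2)
            + B * (4 * (deriv Θ x) ^ 2 + K * (Θ x) ^ 2) + 2 * g x * V x * Θ x := by
      funext x; simp only [rbIntegrand]
    rw [this]
    exact ((continuous_const.mul (((continuous_const.mul (hV2c.pow 2)).div_const K |>.add
      (continuous_const.mul (hV1c.pow 2))).add (continuous_const.mul (hV0c.pow 2)))).add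
      (continuous_const.mul ((continuous_const.mul (hΘ1c.pow 2)).add (continuous_const.mul (hΘ0c.pow 2))))).add
      (((continuous_const.mul hgc).mul hV0c).mul hΘ0c)
  have hdiffInt : |rbForm A B g K (fun x => Vp.eval x) (fun x => Θp.eval x) - F| ≤ 2 * (η * Cst) := by
    rw [hF]
    unfold rbForm
    rw [← intervalIntegral.integral_sub (hIp.intervalIntegrable _ _) (hI.intervalIntegrable _ _)]
    have h1 : ‖∫ x in (-1 : ℝ)..1, (rbIntegrand A B g K (fun x => Vp.eval x) (fun x => Θp.eval x) x
        - rbIntegrand A B g K V Θ x)‖ ≤ (η * Cst) * |1 - (-1)| := by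
      refine norm_integral_le_of_norm_le_const fun t ht => ?_
      rw [Real.norm_eq_abs]
      rcases Set.mem_uIoc.mp ht with h' | h'
      · exact hpt t ⟨h'.1.le, h'.2⟩
      · exfalso; linarith [h'.1, h'.2]
    rw [Real.norm_eq_abs] at h1
    have : |(1 : ℝ) - (-1)| = 2 := by norm_num
    rw [this] at h1
    linarith
  have hFin : F < 0 := hneg
  have : 2 * (η * Cst) = 8 * δ * Cst := by rw [hη]; ring
  rw [this] at hdiffInt
  have := abs_le.mp hdiffInt
  linarith [this.1, this.2, hpos, hδF]

end Summit.NavierStokesRegularity.TurbBounds.RBDensity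

end
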